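import Summits.CriticalPhenomena.CardyFormulaZ2.Theorems.CardyMagicRigidityNestingRigidityHoleGeometry
import HarnessLib

/-!
# Generation one of the Markov cascade: first-generation transfer in balls
# (helper toward stub `stub_cascadeReconstruction`, line `markov-cascade-one-generation`, crux `NestingRigidity`)

Route `CardyMagicRigidity` (sub-problem `CriticalPhenomena/CardyFormulaZ2`), crux
`Summit.CriticalPhenomena.CardyFormulaZ2.Theses.CardyMagicRigidity.NestingRigidity`
(stmt-CriticalPhenomena-4835), line `markov-cascade-one-generation`, registered stub
`stub_cascadeReconstruction : CascadeReconstruction` (`≡ KernelTransfer → DomainLawTransfer`, vocabulary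
of `Theorems/CardyMagicRigidityMarkovCascadeDefs.lean`).  The intended proof of the stub is a CASCADE:
apply `KernelTransfer` (merging of the first-generation kernels along every loop family `u_δ → u` with
two-sided limit) to the round circle to merge the outermost loops of the two closed-b.c. ensembles in the
ball, then iterate inside the holes through the lattice Markov decomposition.  This file proves,
sorry-free, the parts of that argument that are closed today:

* **generation one of the cascade along convergent families of balls** (registered helper
  `kernelTransfer_firstGen_balls`): the round circle `NestingBlind.windLoop c r 1` is two-sided with
  winding interior the open ball (sibling module `CardyMagicRigidityNestingRigidityHoleGeometry`:
  `twoSided_windLoop_one`, `holeOf_windLoop_one`, and the fixed-ball instance `kernelTransfer_ball`) and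
  depends `1`-Lipschitz on centre and radius in the loop metric of `d_CN` (`dist_windLoop_le`,
  `tendsto_windLoop`), so `KernelTransfer` merges the FIRST-GENERATION laws of the closed-b.c. bond-`ℤ²`
  and site-`𝕋` ensembles along every convergent family of balls `B(c_δ, R_δ) → B(c, R)`, `R > 0` — in
  particular along the half-mesh-shifted balls `B(-δ(1+i)/2, R)` through which the planar self-duality
  of bond-`ℤ²` enters the cascade (`kernelTransfer_firstGen_ball_halfMeshShift`);
* **the coupling form of `d_CN`-merging** (`tendsto_cnLawEDist_nhds_zero_iff`,
  `domainLawTransfer_iff_coupling`): `cnLawEDist → 0` iff for every `ε > 0` eventually some coupling has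
  exceptional probability `< ε` — the currency in which the cascade builds couplings generation by
  generation — and the generation bookkeeping `firstGen_union_laterGens`, `isClose_of_union`.

What is NOT here (the remaining content of the stub, inputs absent from the tree): the multi-loop lattice
Markov decomposition in law form, finite-depth tightness (RSW), microscopic soup matching, uniformity of
`KernelTransfer` over the random holes (Aizenman–Burchard tightness + a.s. two-sidedness of limits) and
the external input — continuity in the domain of the closed-b.c. `𝕋` ensemble along loop-convergent hole
families (Camia–Newman, CMP 268 (2006) Thm 5, §5; PTRF 139 (2007); MSRI 55 (2008) Thm 2).  The companion
helpers `CardyMagicRigidityNestingRigidityKernelTransferFamilies.lean` (translated families, uniformity of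
`KernelTransfer` over precompact hole families) and `CardyMagicRigidityNestingRigidityDomainEnsembleGluing.lean`
(measurability of the mixed exceptional events, `d_CN` gluing estimates) supply the other closed parts.
-/

noncomputable section

open MeasureTheory Set Filter Metric
open scoped Topology BigOperators ENNReal Real

namespace Summit.CriticalPhenomena.CardyFormulaZ2.Cruxes.NestingRigidity.MarkovCascadeOneGeneration

open Literature.Probability.RandomPlanarGeometry Literature.Probability.Percolation
  Literature.Probability.LatticeModels
open Summit.CriticalPhenomena.CardyFormulaZ2.Theses.CardyMagicRigidity
open Literature.Barriers.CriticalPhenomena.NestingBlind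

/-! ### Continuity of the circle in its centre and radius (loop metric of `d_CN`) -/

/-- Moving the centre by `c' - c` and the radius by `r' - r` moves the round circle by at most
`dist c c' + dist r r'` in the oriented unbased loop metric (the identity parametrisation already
achieves this uniform bound). -/
theorem dist_windLoop_le (c c' : ℂ) (r r' : ℝ) (n : ℕ) :
    dist (windLoop c r n) (windLoop c' r' n) ≤ dist c c' + dist r r' := by
  unfold windLoop
  rw [UnbasedLoop.dist_mk_mk]
  refine (BasedLoop.dist_le_dist_toCurveClass _ _).trans ?_
  simp only [BasedLoop.toCurveClass_mk]
  change dist (CurveClass.mk (windCurve c r n)) (CurveClass.mk (windCurve c' r' n)) ≤ _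
  rw [CurveClass.mk_eq_separationQuotientMk, SeparationQuotient.dist_mk]
  refine (Curve.dist_le_dist_toContinuousMap _ _).trans ?_
  refine (ContinuousMap.dist_le (add_nonneg dist_nonneg dist_nonneg)).2 fun t ↦ ?_
  change dist (windCurve c r n t) (windCurve c' r' n t) ≤ _
  rw [windCurve_apply, windCurve_apply, dist_eq_norm, Complex.dist_eq, Real.dist_eq]
  have he : ‖Complex.exp (2 * π * Complex.I * n * (t : ℝ))‖ = 1 := by
    rw [show (2 * π * Complex.I * n * (t : ℝ) : ℂ) = ((2 * π * n * (t : ℝ) : ℝ) : ℂ) * Complex.I by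
      push_cast; ring, Complex.norm_exp_ofReal_mul_I]
  calc ‖c + r * Complex.exp (2 * π * Complex.I * n * (t : ℝ)) -
        (c' + r' * Complex.exp (2 * π * Complex.I * n * (t : ℝ)))‖
      = ‖(c - c') + (r - r' : ℝ) * Complex.exp (2 * π * Complex.I * n * (t : ℝ))‖ := by
        congr 1; push_cast; ring
    _ ≤ ‖c - c'‖ + ‖((r - r' : ℝ) : ℂ) * Complex.exp (2 * π * Complex.I * n * (t : ℝ))‖ :=
        norm_add_le _ _
    _ = ‖c - c'‖ + |r - r'| := by rw [norm_mul, he, mul_one, Complex.norm_real, Real.norm_eq_abs]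

/-- **Convergent families of circles**: if the centres and the radii converge then the round circles
converge in the loop metric of `d_CN`. -/
theorem tendsto_windLoop {ι : Type*} {l : Filter ι} {cs : ι → ℂ} {rs : ι → ℝ} {c : ℂ} {r : ℝ}
    (hc : Tendsto cs l (𝓝 c)) (hr : Tendsto rs l (𝓝 r)) (n : ℕ) :
    Tendsto (fun i ↦ windLoop (cs i) (rs i) n) l (𝓝 (windLoop c r n)) := by
  rw [tendsto_iff_dist_tendsto_zero]
  have h0 : Tendsto (fun i ↦ dist (cs i) c + dist (rs i) r) l (𝓝 0) := by
    simpa using (tendsto_iff_dist_tendsto_zero.1 hc).add (tendsto_iff_dist_tendsto_zero.1 hr)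
  exact squeeze_zero (fun _ ↦ dist_nonneg) (fun i ↦ dist_windLoop_le _ _ _ _ n) h0

/-! ### Generation one of the cascade: first-generation transfer in balls -/

/-- **Generation one of the cascade (registered helper toward `stub_cascadeReconstruction`)**:
`KernelTransfer` — merging of the first-generation kernels of the closed-b.c. bond-`ℤ²` and site-`𝕋`
ensembles along every loop family with two-sided limit — applied to the family of round circles
`∂B(c_δ, R_δ) → ∂B(c, R)` (`tendsto_windLoop`; the circle is two-sided, `twoSided_windLoop_one`, with
winding interior the open ball, `holeOf_windLoop_one` — sibling module `…HoleGeometry`) gives: along every convergent family of balls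
`B(c_δ, R_δ)`, `c_δ → c`, `R_δ → R > 0` (`δ → 0⁺`), the laws of the OUTERMOST loops of the two closed-b.c.
ensembles in `B(c_δ, R_δ)` merge in `d_CN`. -/
theorem kernelTransfer_firstGen_balls : KernelTransfer → ∀ (c : ℂ) (cδ : ℝ → ℂ) (R : ℝ) (Rδ : ℝ → ℝ),
    0 < R → Tendsto cδ (𝓝[>] 0) (𝓝 c) → Tendsto Rδ (𝓝[>] 0) (𝓝 R) →
      Tendsto (fun δ : ℝ ↦ LoopConfig.cnLawEDist P2
        (fun ω ↦ firstGen (domLoopsZ2 (Metric.ball (cδ δ) (Rδ δ)) δ ω))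
        PT (fun ω ↦ firstGen (domLoopsT (Metric.ball (cδ δ) (Rδ δ)) δ ω))) (𝓝[>] 0) (𝓝 0) := by
  intro hK c cδ R Rδ hR hc hRδ
  have h := hK (windLoop c R 1) (fun δ ↦ windLoop (cδ δ) (Rδ δ) 1) (twoSided_windLoop_one c hR)
    (tendsto_windLoop hc hRδ 1)
  have hpos : ∀ᶠ δ in 𝓝[>] (0 : ℝ), 0 < Rδ δ := hRδ.eventually (lt_mem_nhds hR)
  refine h.congr' (hpos.mono fun δ hδ ↦ ?_)
  simp only [holeOf_windLoop_one _ hδ]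

/-- **First-generation transfer along the half-mesh-shifted balls** `B(-δ(1+i)/2, R)` — the vertex set of
the dual lattice `ℤ² + (1+i)/2` read in `B(0, R)` at mesh `δ`, the family through which the planar
self-duality of bond-`ℤ²` at `p = 1/2` enters the cascade. -/
theorem kernelTransfer_firstGen_ball_halfMeshShift (hK : KernelTransfer) {R : ℝ} (hR : 0 < R) :
    Tendsto (fun δ : ℝ ↦ LoopConfig.cnLawEDist P2
      (fun ω ↦ firstGen (domLoopsZ2 (ball (-(δ * (1 + Complex.I) / 2)) R) δ ω))
      PT (fun ω ↦ firstGen (domLoopsT (ball (-(δ * (1 + Complex.I) / 2)) R) δ ω)))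
      (𝓝[>] 0) (𝓝 0) := by
  refine kernelTransfer_firstGen_balls hK 0 _ R _ hR ?_ tendsto_const_nhds
  have : Tendsto (fun δ : ℝ ↦ -((δ : ℂ) * (1 + Complex.I) / 2)) (𝓝 0)
      (𝓝 (-((0 : ℝ) * (1 + Complex.I) / 2))) :=
    ((Complex.continuous_ofReal.tendsto 0).mul_const _ |>.div_const _).neg
  simpa using this.mono_left nhdsWithin_le_nhds

/-! ### `d_CN`-merging in coupling form, and the generation bookkeeping of the cascade -/

/-- **`d_CN`-merging in coupling form**: a family of pairs of laws merges in the coupling distance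
(`cnLawEDist → 0`) iff for every `ε > 0`, eventually there is a coupling under which the two
configurations fail to be `ε`-close with probability `< ε` — the form in which the cascade builds
its couplings generation by generation (and in which `DomainLawTransfer`, `KernelTransfer` are
consumed and produced). -/
theorem tendsto_cnLawEDist_nhds_zero_iff {ι Ω Ω' : Type*} [MeasurableSpace Ω] [MeasurableSpace Ω']
    {l : Filter ι} {μ : ι → Measure Ω} {X : ι → Ω → LoopConfig ℂ} {μ' : ι → Measure Ω'}
    {X' : ι → Ω' → LoopConfig ℂ} :
    Tendsto (fun i ↦ LoopConfig.cnLawEDist (μ i) (X i) (μ' i) (X' i)) l (𝓝 0) ↔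
      ∀ ε : ℝ, 0 < ε → ∀ᶠ i in l, ∃ P : Measure (Ω × Ω'), P.map Prod.fst = μ i ∧
        P.map Prod.snd = μ' i ∧
        P {p | ¬ LoopConfig.IsClose ε (X i p.1) (X' i p.2)} < ENNReal.ofReal ε := by
  constructor
  · intro h ε hε
    have hev : ∀ᶠ i in l, LoopConfig.cnLawEDist (μ i) (X i) (μ' i) (X' i) < ENNReal.ofReal ε :=
      h.eventually (gt_mem_nhds (ENNReal.ofReal_pos.2 hε))
    exact hev.mono fun i hi ↦ LoopConfig.exists_coupling_of_cnLawEDist_lt hi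
  · intro h
    rw [ENNReal.tendsto_nhds_zero]
    intro η hη
    by_cases hη1 : 1 ≤ η
    · -- every coupling distance of the laws in question is witnessed below any `ε > 1`
      filter_upwards [h 1 one_pos] with i ⟨P, h₁, h₂, hP⟩
      exact (LoopConfig.cnLawEDist_le_of_coupling one_pos P h₁ h₂ hP).trans
        (by rwa [ENNReal.ofReal_one])
    · push Not at hη1
      have hηtop : η ≠ ⊤ := ne_top_of_lt hη1
      have hη' : 0 < η.toReal := ENNReal.toReal_pos hη.ne' hηtop
      filter_upwards [h η.toReal hη'] with i ⟨P, h₁, h₂, hP⟩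
      exact (LoopConfig.cnLawEDist_le_of_coupling hη' P h₁ h₂ hP).trans
        (ENNReal.ofReal_toReal hηtop).le

/-- `DomainLawTransfer` in coupling form (the shape the cascade has to produce in every ball). -/
theorem domainLawTransfer_iff_coupling : DomainLawTransfer ↔ ∀ R : ℝ, 0 < R → ∀ ε : ℝ, 0 < ε →
    ∀ᶠ δ in 𝓝[>] (0 : ℝ), ∃ P : Measure (BondConfig (Site 2) × SiteConfig (Site 2)),
      P.map Prod.fst = P2 ∧ P.map Prod.snd = PT ∧
      P {p | ¬ LoopConfig.IsClose ε (domLoopsZ2 (ball 0 R) δ p.1) (domLoopsT (ball 0 R) δ p.2)} <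
        ENNReal.ofReal ε :=
  forall₂_congr fun _ _ ↦ tendsto_cnLawEDist_nhds_zero_iff

/-- The first generation is a sub-configuration (same loops, same types). -/
theorem firstGen_subset (c : LoopConfig ℂ) (i : Fin 2) : (firstGen c).F i ⊆ c.F i :=
  fun _ hu ↦ hu.1

/-- Every typed configuration is the union of its first generation and of its later generations
(the loops whose winding interior is strictly inside another loop's): the decomposition iterated
by the cascade. -/
theorem firstGen_union_laterGens (c : LoopConfig ℂ) (i : Fin 2) :
    (firstGen c).F i ∪ {u ∈ c.F i | ∃ v ∈ c.loops, {z | u.wind z ≠ 0} ⊂ {z | v.wind z ≠ 0}} =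
      c.F i := by
  ext u
  simp only [firstGen, mem_union, mem_sep_iff]
  constructor
  · rintro (⟨hu, -⟩ | ⟨hu, -⟩) <;> exact hu
  · intro hu
    by_cases h : ∃ v ∈ c.loops, {z | u.wind z ≠ 0} ⊂ {z | v.wind z ≠ 0}
    · exact Or.inr ⟨hu, h⟩
    · push Not at h
      exact Or.inl ⟨hu, h⟩

/-- **Closeness is assembled generation by generation**: if two configurations are unions
`F i = A i ∪ B i`, `F' i = A' i ∪ B' i` of parts that are separately `ε`-close (`A` to `A'`, `B` to
`B'`), then they are `ε`-close. -/
theorem isClose_of_union {ε : ℝ} {c c' a a' b b' : LoopConfig ℂ}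
    (hc : ∀ i, c.F i = a.F i ∪ b.F i) (hc' : ∀ i, c'.F i = a'.F i ∪ b'.F i)
    (ha : LoopConfig.IsClose ε a a') (hb : LoopConfig.IsClose ε b b') : LoopConfig.IsClose ε c c' := by
  intro i
  refine ⟨fun u hu hr ↦ ?_, fun u' hu' hr ↦ ?_⟩
  · rw [hc i] at hu
    rcases hu with hu | hu
    · obtain ⟨u', hu', hd⟩ := (ha i).1 u hu hr
      exact ⟨u', by rw [hc' i]; exact Or.inl hu', hd⟩
    · obtain ⟨u', hu', hd⟩ := (hb i).1 u hu hr
      exact ⟨u', by rw [hc' i]; exact Or.inr hu', hd⟩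
  · rw [hc' i] at hu'
    rcases hu' with hu' | hu'
    · obtain ⟨u, hu, hd⟩ := (ha i).2 u' hu' hr
      exact ⟨u, by rw [hc i]; exact Or.inl hu, hd⟩
    · obtain ⟨u, hu, hd⟩ := (hb i).2 u' hu' hr
      exact ⟨u, by rw [hc i]; exact Or.inr hu, hd⟩

end Summit.CriticalPhenomena.CardyFormulaZ2.Cruxes.NestingRigidity.MarkovCascadeOneGeneration

end
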